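import Summits.BirchSwinnertonDyer.Rank1Residual.Supersingular.RankOneKimTamDefectGeShape
import Summits.BirchSwinnertonDyer.Rank1Residual.Supersingular.RankOneKimLevelKRecordShape
import HarnessLib

/-!
# Rank ONE, `ord_p #Ш_an = 2j` AND a Tamagawa defect `t = ord_p ∏c_ℓ ≥ 1`: what ONE level-`p^k` Kurihara number,
# `k ≤ 2j + 2 + t`, gives MODULO Kim 2025 (PRE) **and** the `≥` half of Kim's Conjecture 1.10 at the pair — the
# `#Ш_an = 9`, `3 ∣ ∏c` record SHAPE (cell `b2b-bsdres`, supersingular family prover B = unit `b2b-bsdres-additive-p3`,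
# gen 24; class lead N6·O3, X7 joint B side)

HONEST FRAMING (cell `b2b-bsdres-*`, verbatim): prove what is provable now; shrink each hard class to its core with
data; no claim beyond stated classes; COMBINATION classes deleted from PUBLISHED theorems only, CONSTRUCTION-shaped
remainder typed; this is not "finishing BSD". X7 / X8 stay CONSTRUCTION-SHAPED; NOT class theorems; nothing is booked;
no mark moves. Every theorem below is DOUBLY CONDITIONAL: on the ANNOUNCED preprint C.-H. Kim (app. R. Pollack),
arXiv:2505.09121 Thm. 1.1 (`hK25s`, PRE) AND on `hGe : X4.KimTamagawaDefectGeAt W p D.f` = the `≥` half of Kim AJM 148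
Conjecture 1.10 AT THE PAIR (n1011-p12's TYPED `@[conjecture]` predicate; NOT in print in analytic rank one). Glue of
LANDED theorems BY NAME; no definition, no named fact, debt 0; per pair.

## Why (the gap this closes)

The two landed rank-one record shapes at `p = 3` are: (a) gen 21/23's `#Ш_an = 9` shape
(`X8RankOne/X7RankOne.bsdp_three_of_kim2025_OPEN_of_…_of_card_selmerGroup`, `k ≤ 4`, NO Tamagawa hypothesis: Kim's
clause at level `k` gives `ord₃ #Ш ≤ k − 1 ≤ 3`, the descent bit `3 ∣ #Ш` and Cassels–Tate squareness pin `2`) and (b)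
gen 23's TAM-DEFECT shape (`…_of_kimTamagawaDefectGeAt_…_of_shaAn_unit`, `#Ш_an` a unit, `k ≤ t + 2`). A row with
BOTH `ord₃ #Ш_an = 2` and `t = ord₃ ∏c ≥ 2` fits neither: Kim's Conjecture 1.10 puts its first non-vanishing prime-level
number at depth `k = 2 + t + 1 ≥ 5 > 4`, where (a)'s bound `ord₃ #Ш ≤ k − 1 = 4` no longer separates `2` from `4`.
With `hGe` the bound improves to `ord_p #Ш ≤ k − 1 − t` (gen 23 §1,
`RankOne.padicValNat_sha_add_tamagawa_le_of_kim2025_OPEN_of_kimTamagawaDefectGeAt_of_kuriharaNumber_ne_zero`), so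
`k ≤ 2j + 2 + t` suffices: `ord_p #Ш ≤ 2j + 1`, the descent bit `p^{2j−1} ∣ #Ш` and squareness give `ord_p #Ш = 2j`
= `ord_p #Ш_an` ⇒ `BSD(E,p)`. Instance in the cell: O4@3's 260678d1 (`#Ш_an = 9`, `∏c = 18`, `t = 2`, depth `5`,
`q = 243`) — the ONE open rank-one `p = 3` `#Ш_an = 9` cell without a Kim-PRE record after gen 24's level-81 records.

## What

§1 (any `p ≥ 3`, tower): `RankOne.bsdp_of_kim2025_OPEN_of_kimTamagawaDefectGeAt_of_casselsTate_of_kuriharaNumber_ne_zero_of_pow_dvd`.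
§2 (`p = 3`, tower from surj(3)): `X8RankOne/X7RankOne.bsdp_three_of_kim2025_OPEN_of_kimTamagawaDefectGeAt_of_kuriharaNumber_ne_zero_of_card_selmerGroup_of_surj`
(descent COUNT `9 ∣ #Sel^(3)` ⇒ `3 ∣ #Ш` by gen 21's `three_dvd_shaOrder_of_rankOne_of_irr_of_card_selmerGroup`, `j = 1`).
§3 literal integer equations (count by `countPointsFast`, class X8 / X7 decided as in gen 23's shapes):
`X8RankOne/X7RankOne.bsdp_three_of_kim2025_OPEN_of_kimTamagawaDefectGeAt_of_ainvs_of_kuriharaNumber_ne_zero_of_card_selmerGroup`.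

NOT claimed: no class theorem; neither binder is asserted; no number is computed here.

References: [Kim2025RefinedTNC] Thm. 1.1, §7 (ANNOUNCED, OPEN binder); [Kim2022StructureSelmer] Thm. 1.9 (6), Conj. 1.10;
[SilvermanAEC2009] X.4.2(a), X.4.14; [Wuthrich2014] Lemma 20; [Cremona1997] §3.6; [Miller2011LMS] Def. 1.1.
-/

set_option autoImplicit false

noncomputable section

open scoped Classical MatrixGroups ModularForm

open CongruenceSubgroup WeierstrassCurve Literature.NumberTheory.EllipticCurves
  Literature.NumberTheory.EllipticCurves.ModularForms
  Literature.NumberTheory.EllipticCurves.Rank1Residual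
  Literature.NumberTheory.EllipticCurves.Rank1Residual.Typed
  Literature.NumberTheory.EllipticCurves.Rank1Residual.X11RankOneCertificates
  Summit.BirchSwinnertonDyer.BirchSwinnertonDyer.Rank1Residual.IntModel
  Summit.BirchSwinnertonDyer.BirchSwinnertonDyer.Rank1Residual.X11RankOne
  Summit.BirchSwinnertonDyer.Rank1Residual.X11b
  Summit.BirchSwinnertonDyer.Rank1Residual.Additive

namespace Summit.BirchSwinnertonDyer.Rank1Residual.Supersingular

/-! ### §1 Any `p ≥ 3`, under the tower: TAM-DEFECT + descent bit + squareness -/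

section AnyP

variable (W : WeierstrassCurve ℚ) [W.IsElliptic] [W.IsGloballyMinimal] (p : ℕ) [hp : Fact p.Prime]

/-- **`BSD(E,p)` on a rank-one row with `ord_p #Ш_an = 2j` AND a Tamagawa defect `ord_p ∏c_ℓ = t`**, from ONE
level-`p^k` prime Kurihara number with `k ≤ 2j + 2 + t`, the descent bit `p^{2j−1} ∣ #Ш(E/ℚ)` and Cassels–Tate
squareness, MODULO Kim 2025 (PRE) AND Conjecture 1.10's `≥` half at the pair: gen 23's §1 gives
`ord_p #Ш(p) + t ≤ k − 1`, i.e. `ord_p #Ш ≤ 2j + 1`; with `p^{2j−1} ∣ #Ш` and squareness `ord_p #Ш = 2j = ord_p #Ш_an`.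
DOUBLY CONDITIONAL (`hK25s` PRE, `hGe` CONJECTURE); `hCT`/`hGZK`/`hmod` PUBLISHED. Per pair; NOT a class theorem.
[claim: Kim2025RefinedTNC, status: under-review] [cite: Kim2025RefinedTNC, Thm. 1.1 ("BSD") (ANNOUNCED, OPEN binder)]
[cite: Kim2022StructureSelmer, Thm. 1.9 (6) and Conj. 1.10 (PDF p. 8)] [cite: SilvermanAEC2009, Thm. X.4.14]
[cite: Miller2011LMS, §1 and Def. 1.1] -/
theorem RankOne.bsdp_of_kim2025_OPEN_of_kimTamagawaDefectGeAt_of_casselsTate_of_kuriharaNumber_ne_zero_of_pow_dvd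
    (hK25s : Kim2025.thm11_kimShaLength_of_integralPeriod_OPEN)
    (hCT : exists_casselsTate_pairing (K := ℚ))
    (hGZK : rank_eq_analyticRank_of_analyticRank_le_one) (hmod : hasEntireLFunction_rat)
    (hp3 : 3 ≤ p) (hr : W.analyticRank = 1) (htower : ∀ n : ℕ, W.HasSurjectiveModNGaloisRep (p ^ n : ℕ))
    {N : ℕ} [NeZero N] (D : ModularParametrizationData W N) (hGe : X4.KimTamagawaDefectGeAt W p D.f)
    {t : ℕ} (ht : padicValNat p W.tamagawaProduct = t)
    {j k : ℕ} (hk : 1 ≤ k) (hkj : k ≤ 2 * j + 2 + t) (ℓ : ℕ) [Fact ℓ.Prime] (hℓ : Kato.IsKolyvaginPrime W p k ℓ)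
    (hcyc : Nat.card {P : ((WeierstrassCurve.integralModelInt W).map
        (Int.castRingHom (ZMod ℓ))).toAffine.Point // p • P = 0} ≤ p)
    (ψ : (ℓ' : ℕ) → (ZMod ℓ')ˣ →* Multiplicative (ZMod (p ^ k)))
    (hψ : Function.Surjective (ψ ℓ)) (hδ : kuriharaNumber D.f (p ^ k) ℓ ψ ≠ 0)
    (hdvd : p ^ (2 * j - 1) ∣ W.shaOrder)
    {q : ℚ} (hq : shaAn W = (q : ℂ)) (hv : padicValRat p q = 2 * j) : BSDp W p := by
  have hfin : Finite W.sha := (hGZK W (by rw [hr])).2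
  have hle := RankOne.padicValNat_sha_add_tamagawa_le_of_kim2025_OPEN_of_kimTamagawaDefectGeAt_of_kuriharaNumber_ne_zero
    W p hK25s hGZK hmod hp3 hr htower D hGe hk ℓ hℓ hcyc ψ hψ hδ
  rw [ht] at hle
  have heq : padicValNat p W.shaOrder = 2 * j :=
    padicValNat_shaOrder_eq_of_casselsTate_of_pow_dvd_of_le W p hCT hfin hdvd (by omega)
  refine bsdp_of_missingPPartAt W p hGZK (by rw [hr]) ⟨q, hq, ?_⟩
  rw [hv, heq]; push_cast; ring

end AnyP

/-! ### §2 `p = 3`: classes X8 (O3) and X7 (O4@3), tower from surj(3) alone, descent bit from the COUNT `9 ∣ #Sel^(3)` -/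

section Three

variable (W : WeierstrassCurve ℚ) [W.IsElliptic] [W.IsGloballyMinimal]

/-- **O3, `#Ш_an = 9` with a Tamagawa defect (X8 ∧ `r_an = 1` ∧ surj(3) ∧ `ord₃ ∏c = t`)**: `BSD(E,3)` from ONE
level-`3^k` prime Kurihara number, `k ≤ t + 4`, and the two-engine descent COUNT `9 ∣ #Sel^(3)(E/ℚ)`, MODULO Kim
2025 AND Conj. 1.10's `≥` half at the pair; tower by `ClassX8.towerSurj_of_surj`, `3 ∣ #Ш` by gen 21's
`three_dvd_shaOrder_of_rankOne_of_irr_of_card_selmerGroup`. DOUBLY CONDITIONAL. Per pair; NOT a class theorem.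
[claim: Kim2025RefinedTNC, status: under-review] [cite: Kim2025RefinedTNC, Thm. 1.1 (ANNOUNCED, OPEN binder)]
[cite: Kim2022StructureSelmer, Conj. 1.10 (PDF p. 8)] [cite: SilvermanAEC2009, Thm. X.4.2(a) and Thm. X.4.14]
[cite: Wuthrich2014, Lemma 20 (p. 399)] [cite: Miller2011LMS, §1 and Def. 1.1] -/
theorem X8RankOne.bsdp_three_of_kim2025_OPEN_of_kimTamagawaDefectGeAt_of_kuriharaNumber_ne_zero_of_card_selmerGroup_of_surj
    (hK25s : Kim2025.thm11_kimShaLength_of_integralPeriod_OPEN)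
    (hCT : exists_casselsTate_pairing (K := ℚ))
    (hGZK : rank_eq_analyticRank_of_analyticRank_le_one) (hmod : hasEntireLFunction_rat)
    (hr : W.analyticRank = 1) (hX : ClassX8 W 3) (hs : Surj W 3)
    {N : ℕ} [NeZero N] (D : ModularParametrizationData W N) (hGe : X4.KimTamagawaDefectGeAt W 3 D.f)
    {t : ℕ} (ht : padicValNat 3 W.tamagawaProduct = t)
    {k : ℕ} (hk : 1 ≤ k) (hkt : k ≤ t + 4) (ℓ : ℕ) [Fact ℓ.Prime] (hℓ : Kato.IsKolyvaginPrime W 3 k ℓ)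
    (hcyc : Nat.card {P : ((WeierstrassCurve.integralModelInt W).map
        (Int.castRingHom (ZMod ℓ))).toAffine.Point // 3 • P = 0} ≤ 3)
    (ψ : (ℓ'' : ℕ) → (ZMod ℓ'')ˣ →* Multiplicative (ZMod (3 ^ k)))
    (hψ : Function.Surjective (ψ ℓ)) (hδ : kuriharaNumber D.f (3 ^ k) ℓ ψ ≠ 0)
    (hcard : 3 ^ 2 ∣ Nat.card (W.selmerGroup ((3 : ℕ) : ℤ)))
    {q : ℚ} (hq : shaAn W = (q : ℂ)) (hv : padicValRat 3 q = 2) : BSDp W 3 := by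
  haveI : Fact (Nat.Prime 3) := ⟨by norm_num⟩
  have h3 := three_dvd_shaOrder_of_rankOne_of_irr_of_card_selmerGroup W hGZK hr
    (hasIrreducibleModPGaloisRep_of_hasSurjectiveModNGaloisRep W 3 hs) hcard
  exact RankOne.bsdp_of_kim2025_OPEN_of_kimTamagawaDefectGeAt_of_casselsTate_of_kuriharaNumber_ne_zero_of_pow_dvd
    W 3 hK25s hCT hGZK hmod le_rfl hr (ClassX8.towerSurj_of_surj W 3 hX hs) D hGe ht (j := 1) hk (by omega) ℓ hℓ
    hcyc ψ hψ hδ (by simpa using h3) hq (by rw [hv]; norm_num)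

/-- **O4@3, `#Ш_an = 9` with a Tamagawa defect (X7@3 ∧ `r_an = 1` ∧ surj(3) ∧ `ord₃ ∏c = t`)** — the X7 twin
(tower by `ClassX7.towerSurj_of_surj`); instance 260678d1 (`t = 2`, depth `5`). DOUBLY CONDITIONAL; X7 joint pair,
B side. Per pair; NOT a class theorem. [claim: Kim2025RefinedTNC, status: under-review]
[cite: Kim2025RefinedTNC, Thm. 1.1 (ANNOUNCED, OPEN binder)] [cite: Kim2022StructureSelmer, Conj. 1.10 (PDF p. 8)]
[cite: SilvermanAEC2009, Thm. X.4.2(a) and Thm. X.4.14] [cite: Wuthrich2014, Lemma 20 (p. 399)]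
[cite: Miller2011LMS, §1 and Def. 1.1] -/
theorem X7RankOne.bsdp_three_of_kim2025_OPEN_of_kimTamagawaDefectGeAt_of_kuriharaNumber_ne_zero_of_card_selmerGroup_of_surj
    (hK25s : Kim2025.thm11_kimShaLength_of_integralPeriod_OPEN)
    (hCT : exists_casselsTate_pairing (K := ℚ))
    (hGZK : rank_eq_analyticRank_of_analyticRank_le_one) (hmod : hasEntireLFunction_rat)
    (hr : W.analyticRank = 1) (hX : ClassX7 W 3) (hs : Surj W 3)
    {N : ℕ} [NeZero N] (D : ModularParametrizationData W N) (hGe : X4.KimTamagawaDefectGeAt W 3 D.f)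
    {t : ℕ} (ht : padicValNat 3 W.tamagawaProduct = t)
    {k : ℕ} (hk : 1 ≤ k) (hkt : k ≤ t + 4) (ℓ : ℕ) [Fact ℓ.Prime] (hℓ : Kato.IsKolyvaginPrime W 3 k ℓ)
    (hcyc : Nat.card {P : ((WeierstrassCurve.integralModelInt W).map
        (Int.castRingHom (ZMod ℓ))).toAffine.Point // 3 • P = 0} ≤ 3)
    (ψ : (ℓ'' : ℕ) → (ZMod ℓ'')ˣ →* Multiplicative (ZMod (3 ^ k)))
    (hψ : Function.Surjective (ψ ℓ)) (hδ : kuriharaNumber D.f (3 ^ k) ℓ ψ ≠ 0)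
    (hcard : 3 ^ 2 ∣ Nat.card (W.selmerGroup ((3 : ℕ) : ℤ)))
    {q : ℚ} (hq : shaAn W = (q : ℂ)) (hv : padicValRat 3 q = 2) : BSDp W 3 := by
  haveI : Fact (Nat.Prime 3) := ⟨by norm_num⟩
  have h3 := three_dvd_shaOrder_of_rankOne_of_irr_of_card_selmerGroup W hGZK hr
    (hasIrreducibleModPGaloisRep_of_hasSurjectiveModNGaloisRep W 3 hs) hcard
  exact RankOne.bsdp_of_kim2025_OPEN_of_kimTamagawaDefectGeAt_of_casselsTate_of_kuriharaNumber_ne_zero_of_pow_dvd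
    W 3 hK25s hCT hGZK hmod le_rfl hr (ClassX7.towerSurj_of_surj W 3 (by decide) hX hs) D hGe ht (j := 1) hk
    (by omega) ℓ hℓ hcyc ψ hψ hδ (by simpa using h3) hq (by rw [hv]; norm_num)

end Three

/-! ### §3 Literal integer equations `[a₁, a₂, a₃, a₄, a₆]` — RECORD SHAPES (count by `countPointsFast`) -/

section Literal

/-- **RECORD SHAPE, O3 `#Ш_an = 9` TAM-DEFECT (X8, `ord₃ #Ш_an = 2`, `ord₃ ∏c = t`, prime level `ℓ ∈ 𝒫_k`, `k ≤ t + 4`).**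
For an integer equation `[a₁,…,a₆]`: `hmin` (explicit), `3 ∤ Δ`, `countPoints [a] 3 ∈ {1,7}` (class X8); a prime
`ℓ ≥ 5`, `ℓ ∤ Δ`, `ℓ ≡ 1 (mod 3^k)`, `countPointsFast [a] ℓ = n_ℓ`, `3^k ∣ n_ℓ`, and the CUBE TEST — ALL kernel-decidable;
binders: `hsurj` (gen 21's certificate), `r_an = 1`, `D`, `hGe` (Conj. 1.10 `≥` at the pair, OPEN), `ht : ord₃ ∏c = t`
(Cremona datum), `k ≤ t + 4`, a `ψ` surjective at `ℓ` with `kuriharaNumber D.f (3^k) ℓ ψ ≠ 0` (engine datum), the descent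
COUNT `9 ∣ #Sel^(3)`, `#Ш_an = q` with `ord₃ q = 2` ⇒ **`BSD(E,3)`**. DOUBLY CONDITIONAL (`hK25s` PRE, `hGe` CONJECTURE);
`hCT`/`hGZK`/`hmod` PUBLISHED. Per pair; NOT a class theorem; nothing booked. [claim: Kim2025RefinedTNC, status: under-review]
[cite: Kim2025RefinedTNC, Thm. 1.1 (ANNOUNCED, OPEN binder)] [cite: Kim2022StructureSelmer, §1.2.2 and Conj. 1.10]
[cite: SilvermanAEC2009, III.1, VII.1 Remark 1.1, VII.5 Prop. 5.1(a), Thm. X.4.2(a), Thm. X.4.14]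
[cite: IrelandRosen1990, Prop. 5.1.2 and §8.1] [cite: Miller2011LMS, §1 and Def. 1.1] -/
theorem X8RankOne.bsdp_three_of_kim2025_OPEN_of_kimTamagawaDefectGeAt_of_ainvs_of_kuriharaNumber_ne_zero_of_card_selmerGroup
    (hK25s : Kim2025.thm11_kimShaLength_of_integralPeriod_OPEN)
    (hCT : exists_casselsTate_pairing (K := ℚ))
    (hGZK : rank_eq_analyticRank_of_analyticRank_le_one) (hmod : hasEntireLFunction_rat)
    (a1 a2 a3 a4 a6 : ℤ) (hmin : (⟨a1, a2, a3, a4, a6⟩ : WeierstrassCurve ℚ).IsGloballyMinimal)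
    (h3Δ : ¬ (3 : ℤ) ∣ discOf [a1, a2, a3, a4, a6]) {n₃ : ℕ}
    (hc₃ : countPoints [a1, a2, a3, a4, a6] 3 = n₃) (hn17 : n₃ = 1 ∨ n₃ = 7)
    (hsurj : Surj (⟨a1, a2, a3, a4, a6⟩ : WeierstrassCurve ℚ) 3)
    (hr : (⟨a1, a2, a3, a4, a6⟩ : WeierstrassCurve ℚ).analyticRank = 1)
    {N : ℕ} [NeZero N] (D : ModularParametrizationData (⟨a1, a2, a3, a4, a6⟩ : WeierstrassCurve ℚ) N)
    (hGe : X4.KimTamagawaDefectGeAt (⟨a1, a2, a3, a4, a6⟩ : WeierstrassCurve ℚ) 3 D.f)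
    {t : ℕ} (ht : padicValNat 3 (⟨a1, a2, a3, a4, a6⟩ : WeierstrassCurve ℚ).tamagawaProduct = t)
    {k : ℕ} (hk : 1 ≤ k) (hkt : k ≤ t + 4) (ℓ : ℕ) [hℓ : Fact ℓ.Prime] (h5 : 5 ≤ ℓ)
    (hℓΔ : ¬ (ℓ : ℤ) ∣ discOf [a1, a2, a3, a4, a6]) (h1 : ℓ ≡ 1 [MOD 3 ^ k]) {nℓ : ℕ}
    (hnℓ : countPointsFast [a1, a2, a3, a4, a6] ℓ = nℓ) (hdvd : 3 ^ k ∣ nℓ)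
    (hΔ0 : ((discOf [a1, a2, a3, a4, a6] : ℤ) : ZMod ℓ) ≠ 0)
    (hχ : ((discOf [a1, a2, a3, a4, a6] : ℤ) : ZMod ℓ) ^ ((ℓ - 1) / 3) ≠ 1)
    (ψ : (ℓ'' : ℕ) → (ZMod ℓ'')ˣ →* Multiplicative (ZMod (3 ^ k)))
    (hψ : Function.Surjective (ψ ℓ))
    (hδ : kuriharaNumber D.f (3 ^ k) ℓ ψ ≠ 0)
    (hcard : 3 ^ 2 ∣ Nat.card ((⟨a1, a2, a3, a4, a6⟩ : WeierstrassCurve ℚ).selmerGroup ((3 : ℕ) : ℤ)))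
    {q : ℚ} (hq : shaAn (⟨a1, a2, a3, a4, a6⟩ : WeierstrassCurve ℚ) = (q : ℂ)) (hv : padicValRat 3 q = 2) :
    BSDp (⟨a1, a2, a3, a4, a6⟩ : WeierstrassCurve ℚ) 3 := by
  have h0 : discOf [a1, a2, a3, a4, a6] ≠ 0 := fun h ↦ h3Δ (by rw [h]; exact dvd_zero _)
  haveI := isElliptic_of_discOf_ne_zero a1 a2 a3 a4 a6 h0
  haveI := hmin
  haveI : Fact (Nat.Prime 3) := ⟨by norm_num⟩
  have hI : integralModelInt (⟨a1, a2, a3, a4, a6⟩ : WeierstrassCurve ℚ) = ⟨a1, a2, a3, a4, a6⟩ :=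
    integralModelInt_eq_of_map_eq _ (map_mk_int a1 a2 a3 a4 a6)
  have hΔℓ : ((⟨a1, a2, a3, a4, a6⟩ : WeierstrassCurve ℤ).map (Int.castRingHom (ZMod ℓ))).Δ =
      ((discOf [a1, a2, a3, a4, a6] : ℤ) : ZMod ℓ) := by
    rw [WeierstrassCurve.map_Δ, intCurve_Δ, eq_intCast]
  have hX : ClassX8 (⟨a1, a2, a3, a4, a6⟩ : WeierstrassCurve ℚ) 3 :=
    classX8_of_intModel hI (by rw [intCurve_Δ]; exact h3Δ)
      (natCard_point_eq_of_countPoints a1 a2 a3 a4 a6 3 (by decide) h3Δ hc₃) hn17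
  have hnℓ' := natCard_point_eq_of_countPoints a1 a2 a3 a4 a6 ℓ (by omega) hℓΔ (countPoints_eq_of_fast hnℓ)
  exact X8RankOne.bsdp_three_of_kim2025_OPEN_of_kimTamagawaDefectGeAt_of_kuriharaNumber_ne_zero_of_card_selmerGroup_of_surj
    _ hK25s hCT hGZK hmod hr hX hsurj D hGe ht hk hkt ℓ
    (isKolyvaginPrime_of_intModel_of_card hI 3 k ℓ (by omega) (by rw [intCurve_Δ]; exact hℓΔ) h1 hnℓ' hdvd)
    (card_three_torsion_le_of_intModel_of_pow_div_three_ne_one hI ℓ (by rw [hΔℓ]; exact hΔ0) (by rw [hΔℓ]; exact hχ) h5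
      (three_dvd_sub_one_of_modEq_pow hk h1)) ψ hψ hδ hcard hq hv

/-- **RECORD SHAPE, O4@3 `#Ш_an = 9` TAM-DEFECT (X7 at `3`, `ord₃ #Ш_an = 2`, `ord₃ ∏c = t`, prime level
`ℓ ∈ 𝒫_k`, `k ≤ t + 4`)** — the X7 twin: class X7 from `3 ∤ Δ`, `countPoints [a] 3 = n₃` with `3 ∣ 3 + 1 − n₃` and an
ADDITIVE prime `q'` (`q' ∣ Δ`, `q' ∣ c₄`); everything else as the X8 shape. DOUBLY CONDITIONAL (`hK25s` PRE, `hGe`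
CONJECTURE); X7 joint pair, B side. Per pair; NOT a class theorem; nothing booked. [claim: Kim2025RefinedTNC, status: under-review]
[cite: Kim2025RefinedTNC, Thm. 1.1 (ANNOUNCED, OPEN binder)] [cite: Kim2022StructureSelmer, §1.2.2 and Conj. 1.10]
[cite: SilvermanAEC2009, III.1, VII.1 Remark 1.1, VII.5 Prop. 5.1(a) and (c), Thm. X.4.2(a), Thm. X.4.14]
[cite: IrelandRosen1990, Prop. 5.1.2 and §8.1] [cite: Miller2011LMS, §1 and Def. 1.1] -/
theorem X7RankOne.bsdp_three_of_kim2025_OPEN_of_kimTamagawaDefectGeAt_of_ainvs_of_kuriharaNumber_ne_zero_of_card_selmerGroup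
    (hK25s : Kim2025.thm11_kimShaLength_of_integralPeriod_OPEN)
    (hCT : exists_casselsTate_pairing (K := ℚ))
    (hGZK : rank_eq_analyticRank_of_analyticRank_le_one) (hmod : hasEntireLFunction_rat)
    (a1 a2 a3 a4 a6 : ℤ) (hmin : (⟨a1, a2, a3, a4, a6⟩ : WeierstrassCurve ℚ).IsGloballyMinimal)
    (h3Δ : ¬ (3 : ℤ) ∣ discOf [a1, a2, a3, a4, a6]) {n₃ : ℕ}
    (hc₃ : countPoints [a1, a2, a3, a4, a6] 3 = n₃) (ha₃ : (3 : ℤ) ∣ (3 : ℤ) + 1 - n₃)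
    (q' : ℕ) (hq' : q'.Prime) (hqΔ : (q' : ℤ) ∣ discOf [a1, a2, a3, a4, a6])
    (hqc₄ : (q' : ℤ) ∣ c4Of [a1, a2, a3, a4, a6])
    (hsurj : Surj (⟨a1, a2, a3, a4, a6⟩ : WeierstrassCurve ℚ) 3)
    (hr : (⟨a1, a2, a3, a4, a6⟩ : WeierstrassCurve ℚ).analyticRank = 1)
    {N : ℕ} [NeZero N] (D : ModularParametrizationData (⟨a1, a2, a3, a4, a6⟩ : WeierstrassCurve ℚ) N)
    (hGe : X4.KimTamagawaDefectGeAt (⟨a1, a2, a3, a4, a6⟩ : WeierstrassCurve ℚ) 3 D.f)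
    {t : ℕ} (ht : padicValNat 3 (⟨a1, a2, a3, a4, a6⟩ : WeierstrassCurve ℚ).tamagawaProduct = t)
    {k : ℕ} (hk : 1 ≤ k) (hkt : k ≤ t + 4) (ℓ : ℕ) [hℓ : Fact ℓ.Prime] (h5 : 5 ≤ ℓ)
    (hℓΔ : ¬ (ℓ : ℤ) ∣ discOf [a1, a2, a3, a4, a6]) (h1 : ℓ ≡ 1 [MOD 3 ^ k]) {nℓ : ℕ}
    (hnℓ : countPointsFast [a1, a2, a3, a4, a6] ℓ = nℓ) (hdvd : 3 ^ k ∣ nℓ)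
    (hΔ0 : ((discOf [a1, a2, a3, a4, a6] : ℤ) : ZMod ℓ) ≠ 0)
    (hχ : ((discOf [a1, a2, a3, a4, a6] : ℤ) : ZMod ℓ) ^ ((ℓ - 1) / 3) ≠ 1)
    (ψ : (ℓ'' : ℕ) → (ZMod ℓ'')ˣ →* Multiplicative (ZMod (3 ^ k)))
    (hψ : Function.Surjective (ψ ℓ))
    (hδ : kuriharaNumber D.f (3 ^ k) ℓ ψ ≠ 0)
    (hcard : 3 ^ 2 ∣ Nat.card ((⟨a1, a2, a3, a4, a6⟩ : WeierstrassCurve ℚ).selmerGroup ((3 : ℕ) : ℤ)))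
    {q : ℚ} (hq : shaAn (⟨a1, a2, a3, a4, a6⟩ : WeierstrassCurve ℚ) = (q : ℂ)) (hv : padicValRat 3 q = 2) :
    BSDp (⟨a1, a2, a3, a4, a6⟩ : WeierstrassCurve ℚ) 3 := by
  have h0 : discOf [a1, a2, a3, a4, a6] ≠ 0 := fun h ↦ h3Δ (by rw [h]; exact dvd_zero _)
  haveI := isElliptic_of_discOf_ne_zero a1 a2 a3 a4 a6 h0
  haveI := hmin
  haveI : Fact (Nat.Prime 3) := ⟨by norm_num⟩
  have hI : integralModelInt (⟨a1, a2, a3, a4, a6⟩ : WeierstrassCurve ℚ) = ⟨a1, a2, a3, a4, a6⟩ :=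
    integralModelInt_eq_of_map_eq _ (map_mk_int a1 a2 a3 a4 a6)
  have hΔℓ : ((⟨a1, a2, a3, a4, a6⟩ : WeierstrassCurve ℤ).map (Int.castRingHom (ZMod ℓ))).Δ =
      ((discOf [a1, a2, a3, a4, a6] : ℤ) : ZMod ℓ) := by
    rw [WeierstrassCurve.map_Δ, intCurve_Δ, eq_intCast]
  have hX : ClassX7 (⟨a1, a2, a3, a4, a6⟩ : WeierstrassCurve ℚ) 3 :=
    classX7_of_intModel (p := 3) hI (by rw [intCurve_Δ]; exact h3Δ)
      (natCard_point_eq_of_countPoints a1 a2 a3 a4 a6 3 (by decide) h3Δ hc₃) ha₃ q' hq'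
      (by rw [intCurve_Δ]; exact hqΔ) (by rw [intCurve_c₄]; exact hqc₄)
  have hnℓ' := natCard_point_eq_of_countPoints a1 a2 a3 a4 a6 ℓ (by omega) hℓΔ (countPoints_eq_of_fast hnℓ)
  exact X7RankOne.bsdp_three_of_kim2025_OPEN_of_kimTamagawaDefectGeAt_of_kuriharaNumber_ne_zero_of_card_selmerGroup_of_surj
    _ hK25s hCT hGZK hmod hr hX hsurj D hGe ht hk hkt ℓ
    (isKolyvaginPrime_of_intModel_of_card hI 3 k ℓ (by omega) (by rw [intCurve_Δ]; exact hℓΔ) h1 hnℓ' hdvd)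
    (card_three_torsion_le_of_intModel_of_pow_div_three_ne_one hI ℓ (by rw [hΔℓ]; exact hΔ0) (by rw [hΔℓ]; exact hχ) h5
      (three_dvd_sub_one_of_modEq_pow hk h1)) ψ hψ hδ hcard hq hv

end Literal

end Summit.BirchSwinnertonDyer.Rank1Residual.Supersingular

end
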